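import Summits.Ventures.Crystal3D.Theorems.StickyWulffConstantTextureLiminfTexShadowCoverageBarlowSteer2WideDefs
import Summits.Ventures.Crystal3D.Theorems.StickyWulffConstantTextureLiminfTexShadowSemanticCutSteerWideGlue
import Summits.Ventures.Crystal3D.Theorems.StickyWulffConstantTextureLiminfTexShadowFamilyCoaxial
import Summits.Ventures.Crystal3D.Theorems.StickyWulffConstantGenericWallFloorBarlowOrientedGlueApartAtTiltWide
import Summits.Ventures.Crystal3D.Theorems.StickyWulffConstantTextureLiminfLineCountGlueUpApart
import HarnessLib

/-!
# TexShadow row (e) / EDGE-ON option (ε₂): TWO-SIDED steered certificates ⇒ the cell, and the row-(e) closer / semantic cut over the two-sided menu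
# (lane T, crux `TextureLiminfV5`, stmt-Ventures-23912, sub-crux EDGE-ON `stub_edgeOn`; cf-p1 Q-ε₂ (cxvii)(2) / (cxviii)(3); 19480-p2 g12)

HONEST FRAMING. Venture `Summits/Ventures/Crystal3D` (cell `crystal3d-full`), route `route-Ventures-StickyWulffConstant`, helper
`--supports` the law-v5 crux `TextureLiminfV5` (stmt-Ventures-23912).  PURE BOOKKEEPING (census-free, standard axioms); every wall input is a
HYPOTHESIS; no certificate is proved or claimed; rung F-C1 not moved.

WHAT.  The first certificate shape that prices pairs INSIDE the edge-on regime `EdgeOnAt c₀` (both plates flux-infeasible one-sidedly): the two plates'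
steered walker families are paid TOGETHER by lane G's state-additive ledger (G1–G3: `barlow_hlines_oriented_apart_at_tiltWide`) and the table is charged
against the SUM of the two strip rises (T1: `bilayerWallAt_of_lineCount_up₂`).
* `bilayerWallAt_of_steer2_presented` — the core for up-presented frames; **`bilayerWallAt_of_barlowTwoSidedCertifiedSteerWide`** —
  `BarlowTwoSidedCertifiedSteerWide c₀ σ₁ σ₂ L₁ L₂ z₁ v₁ z₂ v₂` ⇒ the cell at `C″(R₀) = ((432 + 1728R₀) + 80(R₀+9) + 3456 + 1152(R₀+1))/2` (`R₀ ≥ 6`) for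
  every table `0 ≤ c ≤ c₀`, in all FOUR presentations (flipping either plate by `basalMirror`, `bilayerWallAt_flip₁/₂`; the flipped plate's lattice pair is
  the original pair swapped, `lattices_pair_flip`);
* `bilayerWallAt_of_barlowMenuSteer2WideCertified` (constant `max (max C C′) C″`, unchanged), `faultedOnAt_of_steer2WideCoverageBarlowOn`,
  `steer2WideCoverageBarlowOn_certified` (identity certificate);
* **`residualFaultedCoreAt_of_semanticCutSteer2Wide(')`** and **`stub_residualFaultedCore_of_semanticCutSteer2Wide`** — the THREE-WAY semantic cut
  {two-sided-menu certified (closed here)} ∪ {read holes `¬EdgeOnAt ∧ ¬Cert₂`} ∪ {**`EdgeOnAt ∧ ¬Cert₂`** = the SHRUNKEN K4}: for the first time the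
  edge-on stub itself can be cut (`stub_edgeOnS : ∃ C, BilayerWallResidualFaultedCoreOnAt (EdgeOnAt (13/25) ∧ ¬BarlowMenuSteer2WideCertified (13/25)) (13/25) C 10`);
* **`edgeOn_of_steer2Cut`** (cf-p1 (cxxxv)): the FROZEN `stub_edgeOn` statement DERIVED from the shrunken `stub_edgeOnS` (`residualFaultedEdgeOnAt_of_steer2Cut`,
  via the on-region cut `residualFaultedCoreOnAt_of_faultedOnAt_union`);
* monotonicity: `residualFaultedCoreOnAt_edgeOnS_of_edgeOn` (the frozen `stub_edgeOn` implies the shrunken one), `residualFaultedCoreOnAt_steer2Holes_of_steerWideHoles`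
  (so v8.5's `stub_readHolesS`/`stub_edgeOn` imply the two new stubs: the re-cut loses nothing).
WHAT THIS IS NOT: no certificate; the engine's measured region is NOT an obligation here; pairs with no steerable up-slot on a plate or with
`rise₁ + rise₂ < √2·c₀` stay in the remainder (mechanism-only corner); F-C1 not moved.
-/

noncomputable section

namespace Summit.Ventures.Crystal3D.Cruxes.TextureLiminf.TexShadow

open Summit.Ventures.Crystal3D Summit.Ventures.Crystal3D.Theorems Finset
open Literature.MathematicalPhysics.StatisticalMechanics (IsHaggSeq fccStacking barlowStacking basalMirror)
open scoped InnerProductSpace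

/-- `√2·c₀ ≤ r` gives `c₀ ≤ √2·r/2`. -/
private theorem le_sqrt_two_mul_div_two₂ {c₀ r : ℝ} (h : Real.sqrt 2 * c₀ ≤ r) : c₀ ≤ Real.sqrt 2 * r / 2 := by
  have h2 : Real.sqrt 2 * Real.sqrt 2 = 2 := Real.mul_self_sqrt (by norm_num)
  have hnn : 0 ≤ Real.sqrt 2 / 2 * (r - Real.sqrt 2 * c₀) :=
    mul_nonneg (div_nonneg (Real.sqrt_nonneg 2) zero_le_two) (sub_nonneg.2 h)
  have hid : Real.sqrt 2 * r / 2 - c₀ = Real.sqrt 2 / 2 * (r - Real.sqrt 2 * c₀) := by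
    linear_combination (c₀ / 2) * h2
  linarith [hid, hnn]

/-- **The two bilayer lattices of the basal-flipped frame are the original frame's two lattices, swapped**: a set distinct from `L·Λ₀` and from
`(twinFrame L (L e₃))·Λ₀` is distinct from `(M∘L)·Λ₀` and from its basal twin's lattice. -/
theorem lattices_pair_flip (L : E3 ≃ₗᵢ[ℝ] E3) {S : Set E3}
    (h : S ≠ L '' fccStacking 1 (Real.sqrt (2 / 3)) ∧ S ≠ (twinFrame L (L e₃)) '' fccStacking 1 (Real.sqrt (2 / 3))) :
    S ≠ (basalMirror.trans L) '' fccStacking 1 (Real.sqrt (2 / 3)) ∧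
      S ≠ (twinFrame (basalMirror.trans L) ((basalMirror.trans L) e₃)) '' fccStacking 1 (Real.sqrt (2 / 3)) := by
  rw [twinFrame_basalMirror_trans, image_basalMirror_trans, ← image_twinFrame_axis]
  exact ⟨h.2, h.1⟩

/-! ## Two-sided steered certificates ⇒ the cell -/

/-- **Core, both plates up-presented** (`0 ≤ (L₁⁻¹e₃)₂`, `0 ≤ (L₂⁻¹(−e₃))₂`): the hypotheses of `barlow_hlines_oriented_apart_at_tiltWide` plus the
two-sided flux clause give the cell at `C″(R₀)` for every table `0 ≤ c ≤ c₀` (`R₀ ≥ 6`). -/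
theorem bilayerWallAt_of_steer2_presented {sE : E3} (hsE : sE ∈ fccSlots) (hcert : ExactOnly 0 (fccSlots.filter fun w => 0 < ⟪w, sE⟫_ℝ))
    (hDS : ∀ F₁ F₂ : E3 ≃ₗᵢ[ℝ] E3, DoubleStarCoaxialAt F₁ F₂) (hCP : CapPairCoaxial)
    {σ₁ σ₂ : ℤ → ℤ} (hσ₁ : IsHaggSeq σ₁) (hσ₂ : IsHaggSeq σ₂) (L₁ L₂ : E3 ≃ₗᵢ[ℝ] E3) (s₁ s₂ : E3)
    (hax₁ : 0 ≤ (L₁.symm e₃) 2) (hax₂ : 0 ≤ (L₂.symm (-e₃)) 2) {c₀ : ℝ}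
    {z₁ v₁ : E3} (hz₁ : ‖z₁‖ = 1) (hz₁e : ‖z₁ - e₃‖ ≤ 1 / 3) (hv₁ : v₁ ∈ fccSlots) (hv₁2 : v₁ 2 = Real.sqrt (2 / 3))
    (hsteep₁ : Real.sqrt 2 / 2 ≤ ⟪L₁ v₁, z₁⟫_ℝ)
    (hrq₁ : ∀ i, σ₁ i = -1 → (1 / 4 : ℝ) ≤ ⟪L₁ (basalMirror (bestCapper (twinFrame L₁ (L₁ e₃)) (L₁ e₃) z₁)), e₃⟫_ℝ)
    {z₂ v₂ : E3} (hz₂ : ‖z₂‖ = 1) (hz₂e : ‖z₂ - (-e₃)‖ ≤ 1 / 3) (hv₂ : v₂ ∈ fccSlots) (hv₂2 : v₂ 2 = Real.sqrt (2 / 3))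
    (hsteep₂ : Real.sqrt 2 / 2 ≤ ⟪L₂ v₂, z₂⟫_ℝ)
    (hrq₂ : ∀ j, σ₂ j = -1 → (1 / 4 : ℝ) ≤ ⟪L₂ (basalMirror (bestCapper (twinFrame L₂ (L₂ e₃)) (L₂ e₃) z₂)), -e₃⟫_ℝ)
    (hflux : ∀ i j : ℤ, Real.sqrt 2 * c₀ ≤ steerRise L₁ σ₁ e₃ z₁ v₁ i + steerRise L₂ σ₂ (-e₃) z₂ v₂ j)
    (hapart₁ : ∀ F ∈ chainFrames z₁ L₁ v₁,
      F '' fccStacking 1 (Real.sqrt (2 / 3)) ≠ L₂ '' fccStacking 1 (Real.sqrt (2 / 3)) ∧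
      F '' fccStacking 1 (Real.sqrt (2 / 3)) ≠ (twinFrame L₂ (L₂ e₃)) '' fccStacking 1 (Real.sqrt (2 / 3)))
    (hapart₂ : ∀ F ∈ chainFrames z₂ L₂ v₂,
      F '' fccStacking 1 (Real.sqrt (2 / 3)) ≠ L₁ '' fccStacking 1 (Real.sqrt (2 / 3)) ∧
      F '' fccStacking 1 (Real.sqrt (2 / 3)) ≠ (twinFrame L₁ (L₁ e₃)) '' fccStacking 1 (Real.sqrt (2 / 3)))
    (hsep : ∀ F₁ ∈ chainFrames z₁ L₁ v₁, ∀ F₂ ∈ chainFrames z₂ L₂ v₂, ¬ CoAxFrames F₁ F₂)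
    (R₀ : ℝ) (hR₀ : 6 ≤ R₀) (c : ℤ → ℤ → ℝ) (hc0 : ∀ i j, 0 ≤ c i j) (hcc : ∀ i j, c i j ≤ c₀) :
    BilayerWallAt (((432 + 1728 * R₀) + 80 * (R₀ + 9) + 3456 + 1152 * (R₀ + 1)) / 2) R₀ σ₁ σ₂ L₁ L₂ s₁ s₂ c := by
  have hR₀3 : (3 : ℝ) ≤ R₀ := by linarith
  obtain ⟨step₁, step₂, hup₁, hΔ₁, hna₁, hr₁, hup₂, hΔ₂, hna₂, hr₂, hF⟩ :=
    barlow_hlines_oriented_apart_at_tiltWide hsE hcert hDS hCP hσ₁ hσ₂ L₁ L₂ s₁ s₂ hax₁ hax₂ hz₁ hz₁e hv₁ hv₁2 hsteep₁ hrq₁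
      hz₂ hz₂e hv₂ hv₂2 hsteep₂ hrq₂ hapart₁ hapart₂ (fun F₁ h₁ F₂ h₂ => hsep F₁ h₁ F₂ h₂) R₀ hR₀
  -- the ∇-steps, restated with the vocabulary's `e₃`
  have hna₁' : ∀ k, σ₁ k = -1 → step₁ k = basalMirror (bestCapper (twinFrame L₁ (L₁ e₃)) (L₁ e₃) z₁) := hna₁
  have hna₂' : ∀ k, σ₂ k = -1 → step₂ k = basalMirror (bestCapper (twinFrame L₂ (L₂ e₃)) (L₂ e₃) z₂) := hna₂
  refine bilayerWallAt_of_lineCount_up₂ hσ₁ hσ₂ L₁ L₂ s₁ s₂ R₀ (432 + 1728 * R₀) hR₀3 hax₁ hax₂ hup₁ hr₁ hup₂ hr₂ c hc0 ?_ hF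
  intro i j
  refine (hcc i j).trans ?_
  have h1 : steerRise L₁ σ₁ e₃ z₁ v₁ i = ⟪step₁ i, L₁.symm e₃⟫_ℝ := by
    rcases hσ₁ i with h | h
    · rw [steerRise_of_eq_one L₁ e₃ z₁ v₁ h, hΔ₁ i h, ← inner_map_eq_inner_symm]
    · rw [steerRise_of_eq_neg_one L₁ e₃ z₁ v₁ h, hna₁' i h, ← inner_map_eq_inner_symm]
  have h2 : steerRise L₂ σ₂ (-e₃) z₂ v₂ j = ⟪step₂ j, L₂.symm (-e₃)⟫_ℝ := by
    rcases hσ₂ j with h | h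
    · rw [steerRise_of_eq_one L₂ (-e₃) z₂ v₂ h, hΔ₂ j h, ← inner_map_eq_inner_symm]
    · rw [steerRise_of_eq_neg_one L₂ (-e₃) z₂ v₂ h, hna₂' j h, ← inner_map_eq_inner_symm]
  rw [← h1, ← h2]
  exact le_sqrt_two_mul_div_two₂ (hflux i j)

/-- **Two-sided steered families certified ⇒ the cell**, for every table `0 ≤ c ≤ c₀` (`R₀ ≥ 6`), in all four presentations of the two plates. -/
theorem bilayerWallAt_of_barlowTwoSidedCertifiedSteerWide {sE : E3} (hsE : sE ∈ fccSlots)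
    (hcert : ExactOnly 0 (fccSlots.filter fun w => 0 < ⟪w, sE⟫_ℝ))
    (hDS : ∀ F₁ F₂ : E3 ≃ₗᵢ[ℝ] E3, DoubleStarCoaxialAt F₁ F₂) (hCP : CapPairCoaxial)
    {σ₁ σ₂ : ℤ → ℤ} (hσ₁ : IsHaggSeq σ₁) (hσ₂ : IsHaggSeq σ₂) (L₁ L₂ : E3 ≃ₗᵢ[ℝ] E3) (s₁ s₂ : E3)
    {c₀ : ℝ} {z₁ v₁ z₂ v₂ : E3} (hcov : BarlowTwoSidedCertifiedSteerWide c₀ σ₁ σ₂ L₁ L₂ z₁ v₁ z₂ v₂) (R₀ : ℝ) (hR₀ : 6 ≤ R₀)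
    (c : ℤ → ℤ → ℝ) (hc0 : ∀ i j, 0 ≤ c i j) (hcc : ∀ i j, c i j ≤ c₀) :
    BilayerWallAt (((432 + 1728 * R₀) + 80 * (R₀ + 9) + 3456 + 1152 * (R₀ + 1)) / 2) R₀ σ₁ σ₂ L₁ L₂ s₁ s₂ c := by
  obtain ⟨hz₁, hz₁e, hv₁, hv₁2, hsteep₁, hrq₁, hz₂, hz₂e, hv₂, hv₂2, hsteep₂, hrq₂, hflux, hapart₁, hapart₂, hsep⟩ := hcov
  by_cases hax₁ : 0 ≤ (L₁.symm e₃) 2 <;> by_cases hax₂ : 0 ≤ (L₂.symm (-e₃)) 2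
  · -- both plates already up-presented
    have hup₁ : upFrame L₁ e₃ = L₁ := by unfold upFrame; rw [if_pos hax₁]
    have huw₁ : upWord L₁ σ₁ e₃ = σ₁ := by unfold upWord; rw [if_pos hax₁]
    have hup₂ : upFrame L₂ (-e₃) = L₂ := by unfold upFrame; rw [if_pos hax₂]
    have huw₂ : upWord L₂ σ₂ (-e₃) = σ₂ := by unfold upWord; rw [if_pos hax₂]
    rw [hup₁] at hsteep₁ hrq₁ hflux hapart₁ hsep
    rw [huw₁] at hrq₁ hflux
    rw [hup₂] at hsteep₂ hrq₂ hflux hapart₂ hsep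
    rw [huw₂] at hrq₂ hflux
    exact bilayerWallAt_of_steer2_presented hsE hcert hDS hCP hσ₁ hσ₂ L₁ L₂ s₁ s₂ hax₁ hax₂ hz₁ hz₁e hv₁ hv₁2 hsteep₁ hrq₁ hz₂ hz₂e
      hv₂ hv₂2 hsteep₂ hrq₂ hflux hapart₁ hapart₂ hsep R₀ hR₀ c hc0 hcc
  · -- plate 2 flipped
    have hup₁ : upFrame L₁ e₃ = L₁ := by unfold upFrame; rw [if_pos hax₁]
    have huw₁ : upWord L₁ σ₁ e₃ = σ₁ := by unfold upWord; rw [if_pos hax₁]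
    have hup₂ : upFrame L₂ (-e₃) = basalMirror.trans L₂ := by unfold upFrame; rw [if_neg hax₂]
    have huw₂ : upWord L₂ σ₂ (-e₃) = fun n => -σ₂ (-n - 1) := by unfold upWord; rw [if_neg hax₂]
    rw [hup₁] at hsteep₁ hrq₁ hflux hapart₁ hsep
    rw [huw₁] at hrq₁ hflux
    rw [hup₂] at hsteep₂ hrq₂ hflux hapart₂ hsep
    rw [huw₂] at hrq₂ hflux
    have hσ₂' : IsHaggSeq (fun n => -σ₂ (-n - 1)) := isHaggSeq_reverse hσ₂
    have hax₂' : 0 ≤ ((basalMirror.trans L₂).symm (-e₃)) 2 := by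
      have h := upFrame_axis_nonneg L₂ (-e₃)
      rwa [hup₂] at h
    have key := bilayerWallAt_of_steer2_presented hsE hcert hDS hCP hσ₁ hσ₂' L₁ (basalMirror.trans L₂) s₁ s₂ hax₁ hax₂' hz₁ hz₁e
      hv₁ hv₁2 hsteep₁ hrq₁ hz₂ hz₂e hv₂ hv₂2 hsteep₂ hrq₂ hflux (fun F hF => lattices_pair_flip L₂ (hapart₁ F hF)) hapart₂ hsep R₀ hR₀
      (fun i j => c i (-j - 1)) (fun i j => hc0 _ _) (fun i j => hcc _ _)
    exact bilayerWallAt_flip₂.1 key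
  · -- plate 1 flipped
    have hup₁ : upFrame L₁ e₃ = basalMirror.trans L₁ := by unfold upFrame; rw [if_neg hax₁]
    have huw₁ : upWord L₁ σ₁ e₃ = fun n => -σ₁ (-n - 1) := by unfold upWord; rw [if_neg hax₁]
    have hup₂ : upFrame L₂ (-e₃) = L₂ := by unfold upFrame; rw [if_pos hax₂]
    have huw₂ : upWord L₂ σ₂ (-e₃) = σ₂ := by unfold upWord; rw [if_pos hax₂]
    rw [hup₁] at hsteep₁ hrq₁ hflux hapart₁ hsep
    rw [huw₁] at hrq₁ hflux
    rw [hup₂] at hsteep₂ hrq₂ hflux hapart₂ hsep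
    rw [huw₂] at hrq₂ hflux
    have hσ₁' : IsHaggSeq (fun n => -σ₁ (-n - 1)) := isHaggSeq_reverse hσ₁
    have hax₁' : 0 ≤ ((basalMirror.trans L₁).symm e₃) 2 := by
      have h := upFrame_axis_nonneg L₁ e₃
      rwa [hup₁] at h
    have key := bilayerWallAt_of_steer2_presented hsE hcert hDS hCP hσ₁' hσ₂ (basalMirror.trans L₁) L₂ s₁ s₂ hax₁' hax₂ hz₁ hz₁e
      hv₁ hv₁2 hsteep₁ hrq₁ hz₂ hz₂e hv₂ hv₂2 hsteep₂ hrq₂ hflux hapart₁ (fun F hF => lattices_pair_flip L₁ (hapart₂ F hF)) hsep R₀ hR₀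
      (fun i j => c (-i - 1) j) (fun i j => hc0 _ _) (fun i j => hcc _ _)
    exact bilayerWallAt_flip₁.1 key
  · -- both plates flipped
    have hup₁ : upFrame L₁ e₃ = basalMirror.trans L₁ := by unfold upFrame; rw [if_neg hax₁]
    have huw₁ : upWord L₁ σ₁ e₃ = fun n => -σ₁ (-n - 1) := by unfold upWord; rw [if_neg hax₁]
    have hup₂ : upFrame L₂ (-e₃) = basalMirror.trans L₂ := by unfold upFrame; rw [if_neg hax₂]
    have huw₂ : upWord L₂ σ₂ (-e₃) = fun n => -σ₂ (-n - 1) := by unfold upWord; rw [if_neg hax₂]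
    rw [hup₁] at hsteep₁ hrq₁ hflux hapart₁ hsep
    rw [huw₁] at hrq₁ hflux
    rw [hup₂] at hsteep₂ hrq₂ hflux hapart₂ hsep
    rw [huw₂] at hrq₂ hflux
    have hσ₁' : IsHaggSeq (fun n => -σ₁ (-n - 1)) := isHaggSeq_reverse hσ₁
    have hσ₂' : IsHaggSeq (fun n => -σ₂ (-n - 1)) := isHaggSeq_reverse hσ₂
    have hax₁' : 0 ≤ ((basalMirror.trans L₁).symm e₃) 2 := by
      have h := upFrame_axis_nonneg L₁ e₃
      rwa [hup₁] at h
    have hax₂' : 0 ≤ ((basalMirror.trans L₂).symm (-e₃)) 2 := by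
      have h := upFrame_axis_nonneg L₂ (-e₃)
      rwa [hup₂] at h
    have key := bilayerWallAt_of_steer2_presented hsE hcert hDS hCP hσ₁' hσ₂' (basalMirror.trans L₁) (basalMirror.trans L₂) s₁ s₂
      hax₁' hax₂' hz₁ hz₁e hv₁ hv₁2 hsteep₁ hrq₁ hz₂ hz₂e hv₂ hv₂2 hsteep₂ hrq₂ hflux
      (fun F hF => lattices_pair_flip L₂ (hapart₁ F hF)) (fun F hF => lattices_pair_flip L₁ (hapart₂ F hF)) hsep R₀ hR₀
      (fun i j => c (-i - 1) (-j - 1)) (fun i j => hc0 _ _) (fun i j => hcc _ _)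
    have key' : BilayerWallAt (((432 + 1728 * R₀) + 80 * (R₀ + 9) + 3456 + 1152 * (R₀ + 1)) / 2) R₀ (fun n => -σ₁ (-n - 1)) σ₂
        (basalMirror.trans L₁) L₂ s₁ s₂ (fun i j => c (-i - 1) j) :=
      (bilayerWallAt_flip₂ (c := fun i j => c (-i - 1) j)).1 key
    exact bilayerWallAt_flip₁.1 key'

/-- **Two-sided-menu-certified ⇒ the cell** at the constant `max (max C C′) C″` (`R₀ ≥ 6`). -/
theorem bilayerWallAt_of_barlowMenuSteer2WideCertified {sE : E3} (hsE : sE ∈ fccSlots) (hcert : ExactOnly 0 (fccSlots.filter fun w => 0 < ⟪w, sE⟫_ℝ))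
    (hDS : ∀ F₁ F₂ : E3 ≃ₗᵢ[ℝ] E3, DoubleStarCoaxialAt F₁ F₂) (hCP : CapPairCoaxial)
    {σ₁ σ₂ : ℤ → ℤ} (hσ₁ : IsHaggSeq σ₁) (hσ₂ : IsHaggSeq σ₂) (L₁ L₂ : E3 ≃ₗᵢ[ℝ] E3) (s₁ s₂ : E3)
    {c₀ : ℝ} (hcov : BarlowMenuSteer2WideCertified c₀ σ₁ σ₂ L₁ L₂) (R₀ : ℝ) (hR₀ : 6 ≤ R₀)
    (c : ℤ → ℤ → ℝ) (hc0 : ∀ i j, 0 ≤ c i j) (hcc : ∀ i j, c i j ≤ c₀) :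
    BilayerWallAt (max (max ((318 + 192 * R₀ + 80 * (R₀ + 9) + 3456 + 1152 * (R₀ + 1)) / 2)
      (((270 + 576 * R₀) + 80 * (R₀ + 9) + 3456 + 1152 * (R₀ + 1)) / 2))
      (((432 + 1728 * R₀) + 80 * (R₀ + 9) + 3456 + 1152 * (R₀ + 1)) / 2)) R₀ σ₁ σ₂ L₁ L₂ s₁ s₂ c := by
  have hR₀0 : (0 : ℝ) ≤ R₀ := by linarith
  rcases hcov with hmenu | ⟨z₁, v₁, z₂, v₂, htwo⟩
  · exact bilayerWallAt_of_barlowMenuSteerWideCertified hsE hcert hDS hCP hσ₁ hσ₂ L₁ L₂ s₁ s₂ hmenu R₀ hR₀ c hc0 hcc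
  · exact bilayerWallAt_mono hR₀0 (le_max_right _ _)
      (bilayerWallAt_of_barlowTwoSidedCertifiedSteerWide hsE hcert hDS hCP hσ₁ hσ₂ L₁ L₂ s₁ s₂ htwo R₀ hR₀ c hc0 hcc)

/-! ## Two-sided-menu certificate on `Reg` ⇒ the on-`Reg` law; the identity certificate -/

/-- **Two-sided-menu certificate on `Reg` ⇒ `BilayerWallFaultedOnAt Reg c₀ (max (max C C′) C″) R₀`** (`R₀ ≥ 6`). -/
theorem faultedOnAt_of_steer2WideCoverageBarlowOn {sE : E3} (hsE : sE ∈ fccSlots) (hcert : ExactOnly 0 (fccSlots.filter fun w => 0 < ⟪w, sE⟫_ℝ))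
    (hDS : ∀ F₁ F₂ : E3 ≃ₗᵢ[ℝ] E3, DoubleStarCoaxialAt F₁ F₂) (hCP : CapPairCoaxial)
    {Reg : (ℤ → ℤ) → (ℤ → ℤ) → (E3 ≃ₗᵢ[ℝ] E3) → (E3 ≃ₗᵢ[ℝ] E3) → Prop} {c₀ : ℝ}
    (hcov : ResidualSteer2WideCoverageBarlowOn Reg c₀) {R₀ : ℝ} (hR₀ : 6 ≤ R₀) :
    BilayerWallFaultedOnAt Reg c₀ (max (max ((318 + 192 * R₀ + 80 * (R₀ + 9) + 3456 + 1152 * (R₀ + 1)) / 2)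
      (((270 + 576 * R₀) + 80 * (R₀ + 9) + 3456 + 1152 * (R₀ + 1)) / 2))
      (((432 + 1728 * R₀) + 80 * (R₀ + 9) + 3456 + 1152 * (R₀ + 1)) / 2)) R₀ := by
  intro σ₁ σ₂ hσ₁ hσ₂ hf L₁ L₂ s₁ s₂ A₁ A₂ u₁ u₂ _ _ hreg c m hadm
  exact bilayerWallAt_of_barlowMenuSteer2WideCertified hsE hcert hDS hCP hσ₁ hσ₂ L₁ L₂ s₁ s₂ (hcov σ₁ σ₂ hσ₁ hσ₂ hf L₁ L₂ hreg)
    R₀ hR₀ c hadm.1 hadm.2.1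

/-- **The identity certificate, two-sided menu**: on the regime «two-sided-menu certified» every pair is certified. -/
theorem steer2WideCoverageBarlowOn_certified (c₀ : ℝ) : ResidualSteer2WideCoverageBarlowOn (BarlowMenuSteer2WideCertified c₀) c₀ :=
  fun _ _ _ _ _ _ _ h => h

/-! ## The three-way semantic cut over the two-sided menu: {certified} ∪ {read holes} ∪ {shrunken K4} -/

/-- **THE SEMANTIC CUT OVER THE TWO-SIDED MENU, `ExactOnly` form** (`R₀ ≥ 6`): the core on the read holes `¬EdgeOnAt ∧ ¬Cert₂` and the core on the
SHRUNKEN edge-on region `EdgeOnAt ∧ ¬Cert₂` give the registered core — the certified pairs (now including two-sidedly certified EDGE-ON pairs) are closed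
by lanes G+T (`faultedOnAt_of_steer2WideCoverageBarlowOn` on the identity certificate). -/
theorem residualFaultedCoreAt_of_semanticCutSteer2Wide {sE : E3} (hsE : sE ∈ fccSlots)
    (hcert : ExactOnly 0 (fccSlots.filter fun w => 0 < ⟪w, sE⟫_ℝ))
    (hDS : ∀ F₁ F₂ : E3 ≃ₗᵢ[ℝ] E3, DoubleStarCoaxialAt F₁ F₂) (hCP : CapPairCoaxial) {c₀ R₀ : ℝ} (hR₀ : 6 ≤ R₀)
    (hholes : ∃ C : ℝ, BilayerWallResidualFaultedCoreOnAt
      (fun σ₁ σ₂ L₁ L₂ => ¬ EdgeOnAt c₀ σ₁ σ₂ L₁ L₂ ∧ ¬ BarlowMenuSteer2WideCertified c₀ σ₁ σ₂ L₁ L₂) c₀ C R₀)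
    (hK4S : ∃ C : ℝ, BilayerWallResidualFaultedCoreOnAt
      (fun σ₁ σ₂ L₁ L₂ => EdgeOnAt c₀ σ₁ σ₂ L₁ L₂ ∧ ¬ BarlowMenuSteer2WideCertified c₀ σ₁ σ₂ L₁ L₂) c₀ C R₀) :
    ∃ C : ℝ, BilayerWallResidualFaultedCoreAt c₀ C R₀ := by
  have hR₀0 : (0 : ℝ) ≤ R₀ := by linarith
  obtain ⟨C_h, hh⟩ := hholes
  obtain ⟨C_e, he⟩ := hK4S
  -- the core on `¬Cert₂` from the two pieces
  have hrem : BilayerWallResidualFaultedCoreOnAt (fun σ₁ σ₂ L₁ L₂ => ¬ BarlowMenuSteer2WideCertified c₀ σ₁ σ₂ L₁ L₂) c₀ (max C_h C_e) R₀ :=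
    residualFaultedCoreOnAt_anti (Rem := fun σ₁ σ₂ L₁ L₂ =>
        (¬ EdgeOnAt c₀ σ₁ σ₂ L₁ L₂ ∧ ¬ BarlowMenuSteer2WideCertified c₀ σ₁ σ₂ L₁ L₂) ∨
          (EdgeOnAt c₀ σ₁ σ₂ L₁ L₂ ∧ ¬ BarlowMenuSteer2WideCertified c₀ σ₁ σ₂ L₁ L₂))
      (fun σ₁ σ₂ L₁ L₂ hnc => by
        by_cases hE : EdgeOnAt c₀ σ₁ σ₂ L₁ L₂
        · exact Or.inr ⟨hE, hnc⟩
        · exact Or.inl ⟨hE, hnc⟩)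
      (residualFaultedCoreOnAt_union hR₀0 hh he)
  exact ⟨_, residualFaultedCoreAt_of_split (Reg := BarlowMenuSteer2WideCertified c₀)
    (Rem := fun σ₁ σ₂ L₁ L₂ => ¬ BarlowMenuSteer2WideCertified c₀ σ₁ σ₂ L₁ L₂) (fun σ₁ σ₂ L₁ L₂ => em _) hR₀0
    (faultedOnAt_of_steer2WideCoverageBarlowOn hsE hcert hDS hCP (steer2WideCoverageBarlowOn_certified c₀) hR₀) hrem⟩

/-- **THE SEMANTIC CUT OVER THE TWO-SIDED MENU, named-fact form** (`R₀ ≥ 6`). -/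
theorem residualFaultedCoreAt_of_semanticCutSteer2Wide' (hE1 : P5Exhaustion) (hSP : StarPairFar) {c₀ R₀ : ℝ} (hR₀ : 6 ≤ R₀)
    (hholes : ∃ C : ℝ, BilayerWallResidualFaultedCoreOnAt
      (fun σ₁ σ₂ L₁ L₂ => ¬ EdgeOnAt c₀ σ₁ σ₂ L₁ L₂ ∧ ¬ BarlowMenuSteer2WideCertified c₀ σ₁ σ₂ L₁ L₂) c₀ C R₀)
    (hK4S : ∃ C : ℝ, BilayerWallResidualFaultedCoreOnAt
      (fun σ₁ σ₂ L₁ L₂ => EdgeOnAt c₀ σ₁ σ₂ L₁ L₂ ∧ ¬ BarlowMenuSteer2WideCertified c₀ σ₁ σ₂ L₁ L₂) c₀ C R₀) :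
    ∃ C : ℝ, BilayerWallResidualFaultedCoreAt c₀ C R₀ := by
  obtain ⟨sE, hsE, hcert⟩ := exactOnly_star_of_p5Exhaustion hE1
  exact residualFaultedCoreAt_of_semanticCutSteer2Wide hsE hcert (doubleStarCoaxialAt_of_starPairFar hSP)
    (capPairCoaxial_of_starPairFar hSP) hR₀ hholes hK4S

/-- **`stub_residualFaultedCore` BY NAME from the two-sided semantic cut at `(13/25, 10)`**: {E1, StarPairFar,
`stub_readHoles₂ : ∃ C, …CoreOnAt (¬EdgeOnAt (13/25) ∧ ¬BarlowMenuSteer2WideCertified (13/25)) (13/25) C 10`,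
`stub_edgeOnS : ∃ C, …CoreOnAt (EdgeOnAt (13/25) ∧ ¬BarlowMenuSteer2WideCertified (13/25)) (13/25) C 10`}. -/
theorem stub_residualFaultedCore_of_semanticCutSteer2Wide (hE1 : P5Exhaustion) (hSP : StarPairFar)
    (hholes : ∃ C : ℝ, BilayerWallResidualFaultedCoreOnAt
      (fun σ₁ σ₂ L₁ L₂ => ¬ EdgeOnAt (13 / 25) σ₁ σ₂ L₁ L₂ ∧ ¬ BarlowMenuSteer2WideCertified (13 / 25) σ₁ σ₂ L₁ L₂) (13 / 25) C 10)
    (hK4S : ∃ C : ℝ, BilayerWallResidualFaultedCoreOnAt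
      (fun σ₁ σ₂ L₁ L₂ => EdgeOnAt (13 / 25) σ₁ σ₂ L₁ L₂ ∧ ¬ BarlowMenuSteer2WideCertified (13 / 25) σ₁ σ₂ L₁ L₂) (13 / 25) C 10) :
    ∃ C : ℝ, BilayerWallResidualFaultedCoreAt (13 / 25) C 10 :=
  residualFaultedCoreAt_of_semanticCutSteer2Wide' hE1 hSP (by norm_num) hholes hK4S

/-! ## The FROZEN `stub_edgeOn` DERIVED from the shrunken one (cf-p1 (cxxxv): the ideation dossier's target name survives) -/

/-- **On-region cut**: the on-`Reg` law (constant `C₁`) and the core on `Rem` (constant `C₂`) give the core on any region `P ⊆ Reg ∪ Rem`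
at `max C₁ C₂` (`R₀ ≥ 0`). -/
theorem residualFaultedCoreOnAt_of_faultedOnAt_union
    {Reg Rem P : (ℤ → ℤ) → (ℤ → ℤ) → (E3 ≃ₗᵢ[ℝ] E3) → (E3 ≃ₗᵢ[ℝ] E3) → Prop}
    (hcover : ∀ σ₁ σ₂ L₁ L₂, P σ₁ σ₂ L₁ L₂ → Reg σ₁ σ₂ L₁ L₂ ∨ Rem σ₁ σ₂ L₁ L₂) {c₀ C₁ C₂ R₀ : ℝ} (hR₀ : 0 ≤ R₀)
    (h₁ : BilayerWallFaultedOnAt Reg c₀ C₁ R₀) (h₂ : BilayerWallResidualFaultedCoreOnAt Rem c₀ C₂ R₀) :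
    BilayerWallResidualFaultedCoreOnAt P c₀ (max C₁ C₂) R₀ := by
  intro σ₁ σ₂ hσ₁ hσ₂ hf L₁ L₂ s₁ s₂ A₁ A₂ u₁ u₂ hA₁ hA₂ hres hP c m hadm hleaf
  rcases hcover σ₁ σ₂ L₁ L₂ hP with hreg | hrem
  · exact bilayerWallAt_mono hR₀ (le_max_left _ _) (h₁ σ₁ σ₂ hσ₁ hσ₂ hf L₁ L₂ s₁ s₂ A₁ A₂ u₁ u₂ hA₁ hA₂ hreg c m hadm)
  · exact bilayerWallAt_mono hR₀ (le_max_right _ _)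
      (h₂ σ₁ σ₂ hσ₁ hσ₂ hf L₁ L₂ s₁ s₂ A₁ A₂ u₁ u₂ hA₁ hA₂ hres hrem c m hadm hleaf)

/-- **The edge-on residual from the shrunken one, `ExactOnly` form** (`R₀ ≥ 6`): the core on `EdgeOnAt c₀ ∧ ¬Cert₂` gives the core on all of
`EdgeOnAt c₀` — the two-sidedly certified edge-on pairs are closed by `faultedOnAt_of_steer2WideCoverageBarlowOn` (identity certificate). -/
theorem residualFaultedEdgeOnAt_of_steer2Cut {sE : E3} (hsE : sE ∈ fccSlots)
    (hcert : ExactOnly 0 (fccSlots.filter fun w => 0 < ⟪w, sE⟫_ℝ))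
    (hDS : ∀ F₁ F₂ : E3 ≃ₗᵢ[ℝ] E3, DoubleStarCoaxialAt F₁ F₂) (hCP : CapPairCoaxial) {c₀ R₀ : ℝ} (hR₀ : 6 ≤ R₀)
    (hK4S : ∃ C : ℝ, BilayerWallResidualFaultedCoreOnAt
      (fun σ₁ σ₂ L₁ L₂ => EdgeOnAt c₀ σ₁ σ₂ L₁ L₂ ∧ ¬ BarlowMenuSteer2WideCertified c₀ σ₁ σ₂ L₁ L₂) c₀ C R₀) :
    ∃ C : ℝ, BilayerWallResidualFaultedEdgeOnAt c₀ C R₀ := by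
  obtain ⟨C, hC⟩ := hK4S
  exact ⟨_, residualFaultedCoreOnAt_of_faultedOnAt_union (P := EdgeOnAt c₀) (Reg := BarlowMenuSteer2WideCertified c₀)
    (Rem := fun σ₁ σ₂ L₁ L₂ => EdgeOnAt c₀ σ₁ σ₂ L₁ L₂ ∧ ¬ BarlowMenuSteer2WideCertified c₀ σ₁ σ₂ L₁ L₂)
    (fun σ₁ σ₂ L₁ L₂ hE => by
      by_cases hc : BarlowMenuSteer2WideCertified c₀ σ₁ σ₂ L₁ L₂
      · exact Or.inl hc
      · exact Or.inr ⟨hE, hc⟩)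
    (by linarith) (faultedOnAt_of_steer2WideCoverageBarlowOn hsE hcert hDS hCP (steer2WideCoverageBarlowOn_certified c₀) hR₀) hC⟩

/-- **`edgeOn_of_steer2Cut` — the FROZEN `stub_edgeOn` statement DERIVED from the shrunken stub** (cf-p1 (cxxxv), v8.6):
`P5Exhaustion → StarPairFar → (∃ C, …CoreOnAt (EdgeOnAt (13/25) ∧ ¬BarlowMenuSteer2WideCertified (13/25)) (13/25) C 10) →
∃ C, BilayerWallResidualFaultedEdgeOnAt (13/25) C 10`.  So closing `stub_edgeOnS` closes `stub_edgeOn`. -/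
theorem edgeOn_of_steer2Cut (hE1 : P5Exhaustion) (hSP : StarPairFar)
    (hK4S : ∃ C : ℝ, BilayerWallResidualFaultedCoreOnAt
      (fun σ₁ σ₂ L₁ L₂ => EdgeOnAt (13 / 25) σ₁ σ₂ L₁ L₂ ∧ ¬ BarlowMenuSteer2WideCertified (13 / 25) σ₁ σ₂ L₁ L₂) (13 / 25) C 10) :
    ∃ C : ℝ, BilayerWallResidualFaultedEdgeOnAt (13 / 25) C 10 := by
  obtain ⟨sE, hsE, hcert⟩ := exactOnly_star_of_p5Exhaustion hE1
  exact residualFaultedEdgeOnAt_of_steer2Cut hsE hcert (doubleStarCoaxialAt_of_starPairFar hSP) (capPairCoaxial_of_starPairFar hSP)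
    (by norm_num) hK4S

/-! ## Monotonicity (v8.5 → the two-sided cut) -/

/-- **The frozen `stub_edgeOn` implies the shrunken one**: the core on `EdgeOnAt c₀` gives the core on `EdgeOnAt c₀ ∧ ¬Cert₂`. -/
theorem residualFaultedCoreOnAt_edgeOnS_of_edgeOn {c₀ C R₀ : ℝ} (h : BilayerWallResidualFaultedEdgeOnAt c₀ C R₀) :
    BilayerWallResidualFaultedCoreOnAt
      (fun σ₁ σ₂ L₁ L₂ => EdgeOnAt c₀ σ₁ σ₂ L₁ L₂ ∧ ¬ BarlowMenuSteer2WideCertified c₀ σ₁ σ₂ L₁ L₂) c₀ C R₀ :=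
  residualFaultedCoreOnAt_anti (fun _ _ _ _ hx => hx.1) h

/-- **The wide-steered read holes contain the two-sided-menu read holes**: the v8.5 `stub_readHolesS` implies the two-sided one. -/
theorem residualFaultedCoreOnAt_steer2Holes_of_steerWideHoles {c₀ C R₀ : ℝ}
    (h : BilayerWallResidualFaultedCoreOnAt
      (fun σ₁ σ₂ L₁ L₂ => ¬ EdgeOnAt c₀ σ₁ σ₂ L₁ L₂ ∧ ¬ BarlowMenuSteerWideCertified c₀ σ₁ σ₂ L₁ L₂) c₀ C R₀) :
    BilayerWallResidualFaultedCoreOnAt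
      (fun σ₁ σ₂ L₁ L₂ => ¬ EdgeOnAt c₀ σ₁ σ₂ L₁ L₂ ∧ ¬ BarlowMenuSteer2WideCertified c₀ σ₁ σ₂ L₁ L₂) c₀ C R₀ :=
  residualFaultedCoreOnAt_anti (fun _ _ _ _ hx => ⟨hx.1, fun hw => hx.2 (Or.inl hw)⟩) h

end Summit.Ventures.Crystal3D.Cruxes.TextureLiminf.TexShadow

end
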